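import Summits.BirchSwinnertonDyer.BirchSwinnertonDyer.Theorems.PrintX9JetchevSplitRowData
import Summits.BirchSwinnertonDyer.Rank1Residual.X10.LeafDischargeX10b
import HarnessLib

/-!
# J₃ twin (crux 21340, route PrintX10b, rev 3b) of p4's X9 Jetchev chain — ROW FORM of [J] Thm. 5.2 at a core vertex on an X10b Heegner frame

Cell `bsd-print-x9`, seat p3 g2 (idle-prover assignment, plan g3 20:01Z); `--supports stmt-BirchSwinnertonDyer-21340`;
THEOREMS ONLY, route-free (no `Theses` import), nothing booked, no item closed. This file is p4 g2's
`PrintX9JetchevSplitRowData.lean` with the X9 leaf binder `(hX9 : ClassX9 W p)` replaced by `(hX10 : ClassX10 W p)` (so `p = 3`,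
good ordinary at 3, `E[3]` irreducible; the frame binders — `K` imaginary quadratic Heegner for `N_E` with `p` split,
`d_K ∉ {−3,−4}` — unchanged), the ClassX9 dot-lemmas replaced by ty2's ClassX10 twins of the SAME signature
(files F/H/J/K of the discharge interface: `ClassX10.irr/ne_two`, `ClassX10.cor32_localOrder_of_heegner`,
`ClassX10.exists_kolyvaginPrime_addOrderOf_localization_eq(_shift)_of_heegner`), and every X9-chain theorem it calls
replaced by its twin in this series (`…classX10b…` / `…X10b…`, namespace `JET.SplitThree`); p4's p-GENERIC bricks
(`…_of_irreducible_of_split`, `…_of_prop37_2_of_split`, §6 abstractions) are imported, not copied. Statements and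
proofs otherwise byte-for-byte. Lemma 6.1 is ty2's UNCONDITIONAL `ClassX10.exists_kolyvaginPrime_addOrderOf_localization_eq_of_heegner` (file H). CONDITIONAL exactly as the X9 original (named facts displayed as binders); nothing
asserted about any curve. beyond-print: as the X9 original, now at `p = 3` on the rev-3b frames.
[cite: Jetchev2008, Thm. 5.2 (p. 821) and proof] [cite: McCallumLMS1991, §3 Cor. 3.2, §4 Prop. 4.4] [cite: GrossLMS1991, Prop. 3.7 (2)]
-/

set_option autoImplicit false

noncomputable section

open scoped Classical
open WeierstrassCurve IsDedekindDomain NumberField Literature.NumberTheory.EllipticCurves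
  Literature.NumberTheory.EllipticCurves.ModularForms Literature.NumberTheory.EllipticCurves.Jetchev2008
  Literature.NumberTheory.GaloisRepresentations
  Literature.NumberTheory.GaloisRepresentations.DiscreteGaloisModule
open Summit.BirchSwinnertonDyer.Rank1Residual.JET

open Literature.NumberTheory.EllipticCurves.Rank1Residual

namespace Summit.BirchSwinnertonDyer.Rank1Residual.JET.SplitThree

open Summit.BirchSwinnertonDyer.Rank1Residual.JET.Split

/-- **[J] Thm. 5.2 at a core vertex, row form, on an X9 Heegner frame** (`ClassX9 W p`, `K` Heegner for `N_E`
with `p` split, `d_K ∉ {−3,−4}`) — potss g11's `tamagawaExponent_le_mInfty_of_rowData_of_irreducible_of_heegner_of_prop47P2`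
with Lemma 6.1 from ty2's UNCONDITIONAL `ClassX9.exists_kolyvaginPrime_addOrderOf_localization_eq_of_heegner` and Prop. 4.7
from `addOrderOf_localization_kolyvaginClass_mul_eq_of_prop37_2_of_split` (named fact `h37`); every other binder and
the whole proof byte-for-byte. CONCLUSION: `t ≤ m_∞`. CONDITIONAL on `h37` and the displayed structures.
[cite: Jetchev2008, Thm. 5.2 (p. 821) and proof] [cite: McCallumLMS1991, §3 Cor. 3.2, §4 Prop. 4.4] [cite: GrossLMS1991, Prop. 3.7 (2)] -/
theorem tamagawaExponent_le_mInfty_of_rowData_of_classX10b_of_heegner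
    (h37 : GrossLMS1991.prop37_2_frobeniusCongruence)
    (W : WeierstrassCurve ℚ) [W.IsElliptic] [W.IsGloballyMinimal] [NeZero (W.conductorNorm ℤ)]
    (K : Type) [Field K] [NumberField K] (hK : IsImaginaryQuadratic K)
    (hD3 : NumberField.discr K ≠ -3) (hD4 : NumberField.discr K ≠ -4)
    (hH : SatisfiesHeegnerHypothesis (W.conductorNorm ℤ) K)
    (p : ℕ) [Fact p.Prime] (hp2 : p ≠ 2) (hX10 : ClassX10 W p)
    (hHp : SatisfiesHeegnerHypothesis p K)
    (Dt : ModularParametrizationData W (W.conductorNorm ℤ)) (β : ℤ) (ι : K →+* ℂ)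
    [∀ j : ℕ, NumberField (ringClassField K ι j)]
    (τ : K ≃ₐ[ℚ] K) (hτ : τ ≠ 1)
    -- the level `p^k`, the exponents
    (k t mInf : ℕ) (hk : 1 ≤ k) (htk : t < k) (hik : mInf < k)
    -- the core vertex
    (c : ℕ) (hc : Squarefree c)
    (hcK : ∀ ℓ ∈ c.primeFactors, Zhang2014.IsKolyvaginPrime (W.conductorNorm ℤ) W K p ℓ ∧
      k ≤ Zhang2014.kolyvaginIndex W p ℓ)
    (hcore : IsGlobalCoreVertex W K ι τ p k c)
    -- the class `κ = c_k(c)`: sign, Selmer membership, non-vanishing, order (S7)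
    (e : ℤ) (he : e = 1 ∨ e = -1) (d : KolyvaginHeegnerData Dt β ι c)
    (hκsel : d.kolyvaginClass (Fact.out : p.Prime) k ∈
      modifiedSelmerGroup W K ι ((p ^ k : ℕ) : ℤ) c)
    (hκsign : conjAct W τ ((p ^ k : ℕ) : ℤ) (d.kolyvaginClass (Fact.out : p.Prime) k) =
      e • d.kolyvaginClass (Fact.out : p.Prime) k)
    (hκ0 : d.kolyvaginClass (Fact.out : p.Prime) k ≠ 0)
    (hordκ : addOrderOf (d.kolyvaginClass (Fact.out : p.Prime) k) = p ^ (k - mInf))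
    -- the structures: transverse family (reconciled with `transverseKer` on `c`), stringent family, carrier places
    (𝒯 𝒮 : SelmerStructure ((W.baseChange K).torsionGaloisModule ((p ^ k : ℕ) : ℤ)))
    (hT : ∀ x : galoisCohomology ((W.baseChange K).torsionGaloisModule ((p ^ k : ℕ) : ℤ)) 1,
      (∀ w ∈ placesDividing K c,
        galoisCohomology.localization ((W.baseChange K).torsionGaloisModule ((p ^ k : ℕ) : ℤ))
          (Sum.inr w) 1 x ∈ 𝒯 (Sum.inr w)) ↔
      ∀ ℓ ∈ c.primeFactors, x ∈ transverseKer W K ι ((p ^ k : ℕ) : ℤ) ℓ)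
    (hS : ∀ v, 𝒮 v ≤ (W.baseChange K).kummerSelmerStructure ((p ^ k : ℕ) : ℤ) v)
    (Qcar : Finset (HeightOneSpectrum (𝓞 K))) (hQcar : Disjoint Qcar (placesDividing K c))
    -- the dual module `C' = (H_{𝓕₀(c)^*})^{−ε}` (parameter) inside `H^{−ε}`
    (C' : AddSubgroup (galH1Torsion (W.baseChange K) ((p ^ k : ℕ) : ℤ)))
    (hC : C' ≤ signPart W K τ ((p ^ k : ℕ) : ℤ) (-e) ⊤)
    -- Thm 5.1 at the carrier for `𝓕₀(c) ≼ 𝓕(c)` (−ε parts) and (δ): the local quotient is cyclic of order `p^t`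
    (hdual_q : ∃ (Qg Qg' : Type) (_ : AddCommGroup Qg) (_ : AddCommGroup Qg') (_ : Finite Qg')
      (locq : signPart W K τ ((p ^ k : ℕ) : ℤ) (-e) (modifiedSelmerGroup W K ι ((p ^ k : ℕ) : ℤ) c) →+ Qg)
      (locq' : C' →+ Qg'),
      (∀ x : C', locq' x = 0 ↔ (x : galH1Torsion (W.baseChange K) ((p ^ k : ℕ) : ℤ)) ∈
        signPart W K τ ((p ^ k : ℕ) : ℤ) (-e) (modifiedSelmerGroup W K ι ((p ^ k : ℕ) : ℤ) c)) ∧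
      Nat.card locq.range * Nat.card locq'.range = Nat.card Qg' ∧ IsAddCyclic Qg' ∧ Nat.card Qg' = p ^ t)
    -- per Kolyvagin prime `ℓ ∤ c` of index `≥ k`: compatible data on `cℓ`, Prop 4.9 for `cℓ`, duality at `λ`
    (dℓ : ∀ ℓ : ℕ, Zhang2014.IsKolyvaginPrime (W.conductorNorm ℤ) W K p ℓ → k ≤ Zhang2014.kolyvaginIndex W p ℓ →
      ℓ ∉ c.primeFactors → KolyvaginHeegnerData Dt β ι (c * ℓ))
    (hdata : ∀ (ℓ : ℕ) (h1 : Zhang2014.IsKolyvaginPrime (W.conductorNorm ℤ) W K p ℓ)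
      (h2 : k ≤ Zhang2014.kolyvaginIndex W p ℓ) (h3 : ℓ ∉ c.primeFactors),
      (∀ l' ∈ c.primeFactors, ∀ (x : ringClassField K ι c) (x' : ringClassField K ι (c * ℓ)),
        (x : ℂ) = x' → (((dℓ ℓ h1 h2 h3).σ l' x' : ringClassField K ι (c * ℓ)) : ℂ) = (d.σ l' x : ℂ)) ∧
      (∀ s ∈ d.S, ∃ s' ∈ (dℓ ℓ h1 h2 h3).S, ∀ (x : ringClassField K ι c) (x' : ringClassField K ι (c * ℓ)),
        (x : ℂ) = x' → ((s' x' : ringClassField K ι (c * ℓ)) : ℂ) = (s x : ℂ)) ∧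
      (∀ s' ∈ (dℓ ℓ h1 h2 h3).S, ∃ s ∈ d.S, ∀ (x : ringClassField K ι c) (x' : ringClassField K ι (c * ℓ)),
        (x : ℂ) = x' → ((s' x' : ringClassField K ι (c * ℓ)) : ℂ) = (s x : ℂ)) ∧
      (∀ (x : ringClassField K ι c) (x' : ringClassField K ι (c * ℓ)),
        (x : ℂ) = x' → (dℓ ℓ h1 h2 h3).emb x' = d.emb x))
    (h49 : ∀ (ℓ : ℕ) (h1 : Zhang2014.IsKolyvaginPrime (W.conductorNorm ℤ) W K p ℓ)
      (h2 : k ≤ Zhang2014.kolyvaginIndex W p ℓ) (h3 : ℓ ∉ c.primeFactors)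
      (v : HeightOneSpectrum (𝓞 K)), (ℓ : 𝓞 K) ∈ v.asIdeal →
      (dℓ ℓ h1 h2 h3).kolyvaginClass (Fact.out : p.Prime) k ∈
        signPart W K τ ((p ^ k : ℕ) : ℤ) (-e)
          (((selmerF0 W ((p ^ k : ℕ) : ℤ) 𝒯 𝒮 (placesDividing K c) Qcar).relaxedAt {v}).selmerGroup))
    (hdual_ℓ : ∀ (ℓ : ℕ), Zhang2014.IsKolyvaginPrime (W.conductorNorm ℤ) W K p ℓ →
      k ≤ Zhang2014.kolyvaginIndex W p ℓ → ℓ ∉ c.primeFactors →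
      ∀ (v : HeightOneSpectrum (𝓞 K)), (ℓ : 𝓞 K) ∈ v.asIdeal →
      ∃ (Sg : Type) (_ : AddCommGroup Sg)
        (sing : signPart W K τ ((p ^ k : ℕ) : ℤ) (-e)
          (((selmerF0 W ((p ^ k : ℕ) : ℤ) 𝒯 𝒮 (placesDividing K c) Qcar).relaxedAt {v}).selmerGroup) →+ Sg),
        (∀ x, sing x = 0 ↔ (x : galoisCohomology ((W.baseChange K).torsionGaloisModule ((p ^ k : ℕ) : ℤ)) 1) ∈
          signPart W K τ ((p ^ k : ℕ) : ℤ) (-e)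
            ((selmerF0 W ((p ^ k : ℕ) : ℤ) 𝒯 𝒮 (placesDividing K c) Qcar).selmerGroup)) ∧
        Nat.card sing.range *
          Nat.card (C'.map (galoisCohomology.localization
            ((W.baseChange K).torsionGaloisModule ((p ^ k : ℕ) : ℤ)) (Sum.inr v) 1 :
              galH1Torsion (W.baseChange K) ((p ^ k : ℕ) : ℤ) →+ _)) = p ^ k) :
    t ≤ mInf := by
  have hp : p.Prime := Fact.out
  have hc0 : c ≠ 0 := hc.ne_zero
  -- notation
  let H := galH1Torsion (W.baseChange K) ((p ^ k : ℕ) : ℤ)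
  let ρ := (W.baseChange K).torsionGaloisModule ((p ^ k : ℕ) : ℤ)
  let κ : H := d.kolyvaginClass hp k
  let A' : AddSubgroup H := signPart W K τ ((p ^ k : ℕ) : ℤ) (-e)
    (modifiedSelmerGroup W K ι ((p ^ k : ℕ) : ℤ) c)
  let F0 := selmerF0 W ((p ^ k : ℕ) : ℤ) 𝒯 𝒮 (placesDividing K c) Qcar
  let B' : AddSubgroup H := signPart W K τ ((p ^ k : ℕ) : ℤ) (-e) F0.selmerGroup
  -- the index type of usable Kolyvagin primes and the place over each
  let I := {ℓ : ℕ // Zhang2014.IsKolyvaginPrime (W.conductorNorm ℤ) W K p ℓ ∧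
    k ≤ Zhang2014.kolyvaginIndex W p ℓ ∧ ℓ ∉ insert 2 c.primeFactors}
  have hI : ∀ ℓ : I, ℓ.1 ∉ c.primeFactors := fun ℓ h ↦ ℓ.2.2.2 (Finset.mem_insert_of_mem h)
  have hI2 : ∀ ℓ : I, ℓ.1 ≠ 2 := fun ℓ e ↦ ℓ.2.2.2 (Finset.mem_insert.mpr (Or.inl e))
  have hvne : ∀ ℓ : I, Ideal.span {(ℓ.1 : 𝓞 K)} ≠ ⊥ := fun ℓ ↦ by
    rw [Ne, Ideal.span_singleton_eq_bot]
    exact_mod_cast ℓ.2.1.1.ne_zero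
  let v : I → HeightOneSpectrum (𝓞 K) := fun ℓ ↦ ⟨Ideal.span {(ℓ.1 : 𝓞 K)}, ℓ.2.1.2.2.2.2.1, hvne ℓ⟩
  have hv : ∀ ℓ : I, (ℓ.1 : 𝓞 K) ∈ (v ℓ).asIdeal := fun ℓ ↦ Ideal.mem_span_singleton_self _
  let loc : ∀ ℓ : I, H →+ galoisCohomology (ρ.toLocal (Sum.inr (v ℓ))) 1 :=
    fun ℓ ↦ galoisCohomology.localization ρ (Sum.inr (v ℓ)) 1
  let D' : I → AddSubgroup H := fun ℓ ↦ signPart W K τ ((p ^ k : ℕ) : ℤ) (-e)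
    ((F0.relaxedAt {v ℓ}).selmerGroup)
  -- (1) sign selection at the core vertex: `A' = ⊥`
  have hκA : κ ∈ signPart W K τ ((p ^ k : ℕ) : ℤ) e (modifiedSelmerGroup W K ι ((p ^ k : ℕ) : ℤ) c) :=
    (mem_signPart_iff W K τ _ e _ κ).mpr ⟨hκsel, hκsign⟩
  have hcore' : A' = ⊥ := (isGlobalCoreVertex_sign_of_ne_zero W K ι τ p k c hcore he hκA hκ0).2.2
  -- (2) `B' ≤ A'`: `H_{𝓕₀(c)} ≤ H_{𝓕(c)} = modifiedSelmerGroup`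
  have hF0le : F0.selmerGroup ≤ (selmerF W ((p ^ k : ℕ) : ℤ) 𝒯 (placesDividing K c)).selmerGroup := by
    intro x hx
    rw [SelmerStructure.mem_selmerGroup_iff] at hx ⊢
    intro w
    rcases w with w | w
    · simpa [F0, SelmerVocabulary.selmerF0_inl] using hx (Sum.inl w)
    · have hxw := hx (Sum.inr w)
      by_cases hwQ : w ∈ Qcar
      · have hwS : w ∉ placesDividing K c := fun h ↦ (Finset.disjoint_left.mp hQcar) hwQ h
        simp only [F0, SelmerVocabulary.selmerF0_inr, hwQ, if_true] at hxw
        rw [SelmerVocabulary.selmerF_inr, if_neg hwS]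
        exact hS _ hxw
      · simpa [F0, SelmerVocabulary.selmerF0_inr, hwQ] using hxw
  have hFeq : (selmerF W ((p ^ k : ℕ) : ℤ) 𝒯 (placesDividing K c)).selmerGroup =
      modifiedSelmerGroup W K ι ((p ^ k : ℕ) : ℤ) c :=
    SelmerVocabulary.selmerGroup_selmerF_eq_modifiedSelmerGroup W ι ((p ^ k : ℕ) : ℤ) 𝒯 hc0 hT
  have hB'A' : B' ≤ A' := signPart_mono W K τ _ _ (hFeq ▸ hF0le)
  -- (3) the duality packages
  obtain ⟨Qg, Qg', instQ, instQ', instF, locq, locq', hker, horth_q, hcyc, hcard⟩ := hdual_q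
  have hdl := fun ℓ : I ↦ hdual_ℓ ℓ.1 ℓ.2.1 ℓ.2.2.1 (hI ℓ) (v ℓ) (hv ℓ)
  choose Sg instS sing hsing horth_ℓ using hdl
  -- (4) the classes `κ_{cℓ}`
  let κℓ : I → H := fun ℓ ↦ (dℓ ℓ.1 ℓ.2.1 ℓ.2.2.1 (hI ℓ)).kolyvaginClass hp k
  have h49' : ∀ ℓ : I, κℓ ℓ ∈ D' ℓ := fun ℓ ↦ h49 ℓ.1 ℓ.2.1 ℓ.2.2.1 (hI ℓ) (v ℓ) (hv ℓ)
  -- (5) Lemma 6.1 from McCallum Cor 3.2 on the X9 frame — UNCONDITIONAL (ty2 file H)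
  have hey : (-e = 1 ∨ -e = -1) := by rcases he with rfl | rfl <;> norm_num
  have h61 : ∀ y : H, y ∈ C' → y ≠ 0 →
      ∃ ℓ : I, addOrderOf (loc ℓ κ) = addOrderOf κ ∧ addOrderOf (loc ℓ y) = addOrderOf y := by
    intro y hyC hy0
    have hysign : conjAct W τ ((p ^ k : ℕ) : ℤ) y = (-e) • y :=
      ((mem_signPart_iff W K τ _ (-e) ⊤ y).mp (hC hyC)).2
    obtain ⟨ℓ, hℓS, hKol, hidx, hord⟩ :=
      hX10.exists_kolyvaginPrime_addOrderOf_localization_eq_of_heegner (W.conductorNorm ℤ) K hK hH hHp τ hτ k hk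
        he κ y hκsign hysign hy0 (insert 2 c.primeFactors)
    exact ⟨⟨ℓ, hKol, hidx, hℓS⟩, hord (v ⟨ℓ, hKol, hidx, hℓS⟩) (hv ⟨ℓ, hKol, hidx, hℓS⟩)⟩
  -- (6) Prop 4.7 from Gross Prop 3.7 (2) (named fact) on the split row
  have h47 : ∀ ℓ : I, addOrderOf (loc ℓ (κℓ ℓ)) = addOrderOf (loc ℓ κ) := by
    intro ℓ
    have hl : ℓ.1.Prime := ℓ.2.1.1
    have hlc : ¬ ℓ.1 ∣ c := fun h ↦ hI ℓ (Nat.mem_primeFactors.mpr ⟨hl, h, hc0⟩)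
    have hsq : Squarefree (c * ℓ.1) :=
      (Nat.squarefree_mul ((Nat.Prime.coprime_iff_not_dvd hl).mpr hlc).symm).mpr
        ⟨hc, hl.squarefree⟩
    have hK' : ∀ l' ∈ (c * ℓ.1).primeFactors,
        Zhang2014.IsKolyvaginPrime (W.conductorNorm ℤ) W K p l' ∧ k ≤ Zhang2014.kolyvaginIndex W p l' := by
      intro l' hl'
      rw [Nat.primeFactors_mul hc0 hl.ne_zero, Finset.mem_union, hl.primeFactors,
        Finset.mem_singleton] at hl'
      rcases hl' with h | rfl
      · exact hcK l' h
      · exact ⟨ℓ.2.1, ℓ.2.2.1⟩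
    obtain ⟨hσ, hSS, hSS', hemb⟩ := hdata ℓ.1 ℓ.2.1 ℓ.2.2.1 (hI ℓ)
    exact addOrderOf_localization_kolyvaginClass_mul_eq_of_prop37_2_of_split h37 W K hK hD3 hD4 hH p hp2 hX10.irr
      hHp Dt β ι k hk c ℓ.1 hsq hl (hI2 ℓ) hlc hK' d _ hσ hSS hSS' hemb (v ℓ) (hv ℓ)
  -- (7) assemble
  exact Section6.tamagawaExponent_le_mInfty_of_minimalCoreVertex_rowForm hp htk.le hik.le
    loc loc A' B' C' D' hB'A' hcore' locq locq' hker horth_q hcyc hcard κ hordκ h61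
    sing hsing horth_ℓ κℓ h49' h47


end Summit.BirchSwinnertonDyer.Rank1Residual.JET.SplitThree

end
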